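import Mathlib
import HarnessLib
import Summits.Ventures.LatticeQCDFlow.Exactness.IMHKernel

/-!
# Every flux-symmetric accept/reject rule is exact for the flow sampler on a general state space — Metropolis, BARKER, and DELAYED
# ACCEPTANCE with an arbitrary positive surrogate (screen the flow proposal with a cheap action before paying for the exact one)

HONEST FRAMING: exact (Metropolis-corrected) sampling algorithms for lattice gauge theory;
figures of merit are autocorrelation/cost numbers at stated couplings and volumes; no
continuum-physics claim.

Venture `LatticeQCDFlow` (cell pub-lqcd), topic `Exactness`; FANOUT row 30 (lean-1, GEN-42).  NEW WORK of the cell on a GENERAL measurable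
state space over Mathlib (Tonelli, `Kernel.IsReversible`) and the tree's `IMHKernel` (whose `indepMH_isReversible` is the Metropolis instance).
The tree's `Literature/…/BarkerAcceptance.lean`, `DelayedAcceptance.lean` (Christen–Fox ∕ Banterle et al.) and `Scoring/FlowProposalComposites`
are FINITE-state; flows propose on continuous groups.  DEF-FREE: the sampler is any Markov kernel satisfying the displayed accept/reject equation
`K(x, B) = ∫_B a(x, y) q(dy) + (1 − ∫ a(x, y) q(dy))·1_B(x)` for an acceptance function `a ≤ 1` (hypothesis `hK`).

## Results (no `sorry`, no new definitions)
* §1 **`fluxSymmetric_setLIntegral`** — the mass flow `∫_A K(x, B) π(dx)` splits into `∫_A∫_B w(x)a(x, y) dq dq` plus a diagonal term symmetric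
  in `(A, B)`; **`fluxSymmetric_isReversible`** — if `w(x)·a(x, y) = w(y)·a(y, x)` ("flux symmetry") then `K` is in DETAILED BALANCE with
  `π = w·q`; **`fluxSymmetric_invariant`** — `π` is invariant.  EVERY SUCH RULE IS EXACT, whatever the flow.
* §2 BARKER'S RULE `a(x, y) = w(y)/(w(x) + w(y))` (select between the current configuration and the proposal `∝` weight — the `n = 1` ensemble
  sampler): `barker_flux_symm`, `barker_le_one`, `measurable_barker`, **`barker_isReversible`**; `barker_sandwich` ∕ `barker_setLIntegral_sandwich`
  (the factor-two sandwich `½·a_MH ≤ a_Barker ≤ a_MH`, pointwise and on every set of proposals).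
* §3 DELAYED ACCEPTANCE WITH A SURROGATE `w₁ > 0` (the pure-gauge weight without the determinant, a cheaper flow's density ratio, a truncated
  action): `a(x, y) = min(1, w₁(y)/w₁(x))·min(1, w(y)w₁(x)/(w(x)w₁(y)))` — stage 1 screens with the surrogate, stage 2 pays for the exact weight
  only on survivors.  `delayedAcceptance_closedForm` (`w(x)·a(x, y) = min(w₁x, w₁y)·min(w(x)w₁(y), w(y)w₁(x))/(w₁(x)w₁(y))`),
  `delayedAcceptance_flux_symm`, `delayedAcceptance_le_one`, `measurable_delayedAcceptance`, **`delayedAcceptance_isReversible`** — EXACT FOR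
  EVERY POSITIVE SURROGATE; and its price: `min_one_mul_min_one_le` (`min(1,u)·min(1,v) ≤ min(1,uv)`), **`delayedAcceptance_le_imhAccept`** — the
  two-stage rule never accepts more than the one-stage Metropolis rule `min(1, w(y)/w(x))`, pointwise, hence `delayedAcceptance_mass_le` in the
  mean: screening buys cheaper rejections, not more acceptances; and the converse `delayedAcceptance_ge` ∕ `delayedAcceptance_ge_exp` — a
  surrogate right to within `δ` on every log-ratio keeps at least the fraction `e^{−δ}` of the Metropolis acceptance.
* §4 THE KENNEDY–KUTI LINEAR RULE `a(x, y) = l(1 + w(y)/w(x))` ("noise without noise"; the tree's `Literature/…/LinearAcceptance.lean` is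
  finite-state): `linearAccept_flux_symm`, `linearAccept_le_one` (a probability while `l(1 + R) ≤ 1`, `R` a bound on the weight ratios),
  **`linearAccept_isReversible`** — exact on a general state space; `linearAccept_noise_average` — LINEARITY: run with an unbiased estimate of
  the ratio (a fresh stochastic determinant ratio at every test) the noise-averaged acceptance IS the linear rule, so the chain as run is exact
  as long as no realised value leaves `[0, 1]`; `linearAccept_le_imhAccept` — its price: never more acceptance than Metropolis.
Reading (gauge files): an exact flow sampler for `e^{−S_g} det D` may first test the proposal against `e^{−S_g}` (or any positive surrogate) and
evaluate the determinant ratio only if that test passes; the sampled law is still exactly the target.  NOT CLAIMED: variance orderings (Peskun;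
finite-state in the Literature files), anything about the surrogate's quality beyond the pointwise acceptance comparison.
-/

noncomputable section

namespace Summit.Ventures.LatticeQCDFlow.Exactness

open MeasureTheory ProbabilityTheory
open scoped ENNReal

variable {Ω : Type*} [MeasurableSpace Ω] {q : Measure Ω} [IsProbabilityMeasure q] {w : Ω → ℝ}

/-! ## §1 Flux symmetry ⇒ detailed balance, for any accept/reject rule -/

/-- **THE MASS FLOW of an accept/reject kernel**: for `π = w·q` and `K(x, B) = ∫_B a(x, y) dq + (1 − ∫ a(x, ·) dq)·1_B(x)`,
`∫_A K(x, B) π(dx) = ∫_A ∫_B w(x)a(x, y) q(dy) q(dx) + ∫_{B ∩ A} w(x)(1 − ∫ a(x, ·) dq) q(dx)`. [ours] -/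
theorem fluxSymmetric_setLIntegral (hw : Measurable w) {a : Ω → Ω → ℝ≥0∞} (ha : Measurable (Function.uncurry a))
    (K : Kernel Ω Ω) (hK : ∀ (x : Ω) {B : Set Ω}, MeasurableSet B → K x B = ∫⁻ y in B, a x y ∂q + (1 - ∫⁻ y, a x y ∂q) * B.indicator 1 x)
    {A B : Set Ω} (hA : MeasurableSet A) (hB : MeasurableSet B) :
    ∫⁻ x in A, K x B ∂(q.withDensity fun x => ENNReal.ofReal (w x)) =
      (∫⁻ x in A, ∫⁻ y in B, ENNReal.ofReal (w x) * a x y ∂q ∂q) +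
        ∫⁻ x in B ∩ A, ENNReal.ofReal (w x) * (1 - ∫⁻ y, a x y ∂q) ∂q := by
  have hd : Measurable fun x => ENNReal.ofReal (w x) := hw.ennreal_ofReal
  have hKm : Measurable fun x => K x B := Kernel.measurable_coe _ hB
  have hmass : Measurable fun x => ∫⁻ y, a x y ∂q := ha.lintegral_prod_right'
  have hR : Measurable fun x => 1 - ∫⁻ y, a x y ∂q := measurable_const.sub hmass
  rw [setLIntegral_withDensity_eq_setLIntegral_mul _ hd hKm hA]
  simp only [Pi.mul_apply]
  have hpt : ∀ x, ENNReal.ofReal (w x) * K x B =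
      ENNReal.ofReal (w x) * ∫⁻ y in B, a x y ∂q + B.indicator (fun x => ENNReal.ofReal (w x) * (1 - ∫⁻ y, a x y ∂q)) x := by
    intro x
    rw [hK x hB, mul_add]
    congr 1
    by_cases hx : x ∈ B
    · rw [Set.indicator_of_mem hx, Set.indicator_of_mem hx, Pi.one_apply, mul_one]
    · rw [Set.indicator_of_notMem hx, Set.indicator_of_notMem hx, mul_zero, mul_zero]
  simp_rw [hpt]
  have hind : Measurable (B.indicator fun x => ENNReal.ofReal (w x) * (1 - ∫⁻ y, a x y ∂q)) := (hd.mul hR).indicator hB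
  rw [lintegral_add_right _ hind, lintegral_indicator hB, Measure.restrict_restrict hB]
  congr 1
  refine lintegral_congr fun x => ?_
  rw [← lintegral_const_mul _ (ha.of_uncurry_left)]

/-- **FLUX SYMMETRY ⇒ DETAILED BALANCE**: if `w(x)·a(x, y) = w(y)·a(y, x)` for all `x, y`, the accept/reject kernel is reversible with respect
to `π = w·q` — for EVERY flow law `q`. [ours] -/
theorem fluxSymmetric_isReversible (hw : Measurable w) {a : Ω → Ω → ℝ≥0∞} (ha : Measurable (Function.uncurry a))
    (hsym : ∀ x y, ENNReal.ofReal (w x) * a x y = ENNReal.ofReal (w y) * a y x)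
    (K : Kernel Ω Ω) (hK : ∀ (x : Ω) {B : Set Ω}, MeasurableSet B → K x B = ∫⁻ y in B, a x y ∂q + (1 - ∫⁻ y, a x y ∂q) * B.indicator 1 x) :
    Kernel.IsReversible K (q.withDensity fun x => ENNReal.ofReal (w x)) := by
  intro A B hA hB
  rw [fluxSymmetric_setLIntegral hw ha K hK hA hB, fluxSymmetric_setLIntegral hw ha K hK hB hA, Set.inter_comm]
  congr 1
  have hs : Measurable (Function.uncurry fun x y : Ω => ENNReal.ofReal (w x) * a x y) :=
    (hw.ennreal_ofReal.comp measurable_fst).mul ha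
  rw [lintegral_lintegral_swap (hs.aemeasurable (μ := (q.restrict A).prod (q.restrict B)))]
  refine lintegral_congr fun y => lintegral_congr fun x => ?_
  exact hsym x y

/-- **… HENCE `π` IS INVARIANT**: every flux-symmetric accept/reject rule on flow proposals samples `π = w·q` exactly. [ours] -/
theorem fluxSymmetric_invariant (hw : Measurable w) {a : Ω → Ω → ℝ≥0∞} (ha : Measurable (Function.uncurry a))
    (hsym : ∀ x y, ENNReal.ofReal (w x) * a x y = ENNReal.ofReal (w y) * a y x)
    (K : Kernel Ω Ω) [IsMarkovKernel K]
    (hK : ∀ (x : Ω) {B : Set Ω}, MeasurableSet B → K x B = ∫⁻ y in B, a x y ∂q + (1 - ∫⁻ y, a x y ∂q) * B.indicator 1 x) :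
    Kernel.Invariant K (q.withDensity fun x => ENNReal.ofReal (w x)) :=
  (fluxSymmetric_isReversible hw ha hsym K hK).invariant

omit [MeasurableSpace Ω] in
/-- The Metropolis rule is the flux-symmetric instance of `IMHKernel`: `w(x)·min(1, w(y)/w(x)) = w(y)·min(1, w(x)/w(y))`. [ours, bookkeeping] -/
theorem imh_flux_symm (hw0 : ∀ x, 0 < w x) (x y : Ω) :
    ENNReal.ofReal (w x) * imhAcceptE w x y = ENNReal.ofReal (w y) * imhAcceptE w y x := by
  rw [ofReal_mul_imhAcceptE hw0, ofReal_mul_imhAcceptE hw0, min_comm]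

/-! ## §2 Barker's rule -/

omit [MeasurableSpace Ω] in
/-- **Barker's flux symmetry**: `w(x)·w(y)/(w(x) + w(y)) = w(y)·w(x)/(w(y) + w(x))`. [ours] -/
theorem barker_flux_symm (hw0 : ∀ x, 0 < w x) (x y : Ω) :
    ENNReal.ofReal (w x) * ENNReal.ofReal (w y / (w x + w y)) = ENNReal.ofReal (w y) * ENNReal.ofReal (w x / (w y + w x)) := by
  rw [← ENNReal.ofReal_mul (hw0 x).le, ← ENNReal.ofReal_mul (hw0 y).le]
  congr 1
  rw [add_comm (w y)]
  ring

omit [MeasurableSpace Ω] in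
/-- Barker's acceptance is at most one. [ours, bookkeeping] -/
theorem barker_le_one (hw0 : ∀ x, 0 < w x) (x y : Ω) : ENNReal.ofReal (w y / (w x + w y)) ≤ 1 := by
  rw [← ENNReal.ofReal_one]
  refine ENNReal.ofReal_le_ofReal ((div_le_one (add_pos (hw0 x) (hw0 y))).2 ?_)
  linarith [hw0 x]

/-- Barker's acceptance is jointly measurable. [ours, bookkeeping] -/
theorem measurable_barker (hw : Measurable w) :
    Measurable (Function.uncurry fun x y : Ω => ENNReal.ofReal (w y / (w x + w y))) :=
  ((hw.comp measurable_snd).div ((hw.comp measurable_fst).add (hw.comp measurable_snd))).ennreal_ofReal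

/-- **BARKER'S RULE ON FLOW PROPOSALS IS EXACT ON A GENERAL STATE SPACE**: any Markov kernel with
`K(x, B) = ∫_B w(y)/(w(x) + w(y)) q(dy) + (1 − ∫ w(y)/(w(x) + w(y)) q(dy))·1_B(x)` is reversible with respect to `π = w·q` and leaves it
invariant. [ours] -/
theorem barker_isReversible (hw : Measurable w) (hw0 : ∀ x, 0 < w x) (K : Kernel Ω Ω) [IsMarkovKernel K]
    (hK : ∀ (x : Ω) {B : Set Ω}, MeasurableSet B → K x B = ∫⁻ y in B, ENNReal.ofReal (w y / (w x + w y)) ∂q +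
      (1 - ∫⁻ y, ENNReal.ofReal (w y / (w x + w y)) ∂q) * B.indicator 1 x) :
    Kernel.IsReversible K (q.withDensity fun x => ENNReal.ofReal (w x)) ∧
      Kernel.Invariant K (q.withDensity fun x => ENNReal.ofReal (w x)) :=
  ⟨fluxSymmetric_isReversible hw (measurable_barker hw) (barker_flux_symm hw0) K hK,
    fluxSymmetric_invariant hw (measurable_barker hw) (barker_flux_symm hw0) K hK⟩

omit [MeasurableSpace Ω] in
/-- **Barker vs Metropolis, pointwise (the factor-two sandwich on a general state space)**: `½·min(1, w(y)/w(x)) ≤ w(y)/(w(x) + w(y)) ≤ min(1, w(y)/w(x))`.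
[ours] -/
theorem barker_sandwich (hw0 : ∀ x, 0 < w x) (x y : Ω) :
    imhAccept w x y / 2 ≤ w y / (w x + w y) ∧ w y / (w x + w y) ≤ imhAccept w x y := by
  unfold imhAccept
  have hx := hw0 x; have hy := hw0 y
  have hxy : 0 < w x + w y := add_pos hx hy
  constructor
  · rw [div_le_iff₀ (by norm_num : (0:ℝ) < 2), div_mul_eq_mul_div, le_div_iff₀ hxy]
    rcases le_total (w y) (w x) with h | h
    · rw [min_eq_right ((div_le_one hx).2 h)]
      rw [div_mul_eq_mul_div, div_le_iff₀ hx]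
      nlinarith
    · rw [min_eq_left ((one_le_div hx).2 h)]
      linarith
  · refine le_min ((div_le_one hxy).2 (by linarith)) ?_
    exact div_le_div_of_nonneg_left hy.le hx (by linarith)

omit [IsProbabilityMeasure q] in
/-- … hence the Barker kernel moves into any set not containing the current state at least half as often, and at most as often, as the Metropolis
kernel: `½·∫_B min(1, w(y)/w(x)) q(dy) ≤ ∫_B w(y)/(w(x) + w(y)) q(dy) ≤ ∫_B min(1, w(y)/w(x)) q(dy)`. [ours] -/
theorem barker_setLIntegral_sandwich (hw0 : ∀ x, 0 < w x) (x : Ω) (B : Set Ω) :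
    (∫⁻ y in B, imhAcceptE w x y ∂q) / 2 ≤ ∫⁻ y in B, ENNReal.ofReal (w y / (w x + w y)) ∂q ∧
      ∫⁻ y in B, ENNReal.ofReal (w y / (w x + w y)) ∂q ≤ ∫⁻ y in B, imhAcceptE w x y ∂q := by
  constructor
  · rw [ENNReal.div_eq_inv_mul, ← lintegral_const_mul' _ _ (by simp)]
    refine lintegral_mono fun y => ?_
    have h2 : (2 : ℝ≥0∞)⁻¹ = ENNReal.ofReal (2⁻¹ : ℝ) := by
      rw [ENNReal.ofReal_inv_of_pos (by norm_num : (0:ℝ) < 2), ENNReal.ofReal_ofNat]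
    rw [imhAcceptE, h2, ← ENNReal.ofReal_mul (by norm_num), inv_mul_eq_div]
    exact ENNReal.ofReal_le_ofReal (barker_sandwich hw0 x y).1
  · exact lintegral_mono fun y => ENNReal.ofReal_le_ofReal (barker_sandwich hw0 x y).2

/-! ## §3 Delayed acceptance with an arbitrary positive surrogate -/

/-- **The closed form of the delayed-acceptance flux**: for positive `a = w₁(x)`, `b = w₁(y)`, `c = w(x)`, `d = w(y)`,
`c·min(1, b/a)·min(1, d·a/(c·b)) = min(a, b)·min(c·b, d·a)/(a·b)`. [ours] -/
theorem delayedAcceptance_closedForm {a b c d : ℝ} (ha : 0 < a) (hb : 0 < b) (hc : 0 < c) :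
    c * (min 1 (b / a) * min 1 (d * a / (c * b))) = min a b * min (c * b) (d * a) / (a * b) := by
  have h1 : min 1 (b / a) = min a b / a := by
    rw [← min_div_div_right ha.le, div_self ha.ne']
  have h2 : min 1 (d * a / (c * b)) = min (c * b) (d * a) / (c * b) := by
    rw [← min_div_div_right (mul_pos hc hb).le, div_self (mul_pos hc hb).ne']
  rw [h1, h2]
  field_simp

omit [MeasurableSpace Ω] in
/-- **DELAYED-ACCEPTANCE FLUX SYMMETRY**: `w(x)·a_DA(x, y) = w(y)·a_DA(y, x)` for every positive surrogate `w₁` and weight `w`. [ours] -/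
theorem delayedAcceptance_flux_symm_real {w₁ : Ω → ℝ} (hw0 : ∀ x, 0 < w x) (hw₁ : ∀ x, 0 < w₁ x) (x y : Ω) :
    w x * (min 1 (w₁ y / w₁ x) * min 1 (w y * w₁ x / (w x * w₁ y))) =
      w y * (min 1 (w₁ x / w₁ y) * min 1 (w x * w₁ y / (w y * w₁ x))) := by
  rw [delayedAcceptance_closedForm (hw₁ x) (hw₁ y) (hw0 x), delayedAcceptance_closedForm (hw₁ y) (hw₁ x) (hw0 y),
    min_comm (w₁ x), min_comm (w x * w₁ y), mul_comm (w₁ x)]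

omit [MeasurableSpace Ω] in
/-- The `ℝ≥0∞` form of the delayed-acceptance flux symmetry. [ours] -/
theorem delayedAcceptance_flux_symm {w₁ : Ω → ℝ} (hw0 : ∀ x, 0 < w x) (hw₁ : ∀ x, 0 < w₁ x) (x y : Ω) :
    ENNReal.ofReal (w x) * ENNReal.ofReal (min 1 (w₁ y / w₁ x) * min 1 (w y * w₁ x / (w x * w₁ y))) =
      ENNReal.ofReal (w y) * ENNReal.ofReal (min 1 (w₁ x / w₁ y) * min 1 (w x * w₁ y / (w y * w₁ x))) := by
  rw [← ENNReal.ofReal_mul (hw0 x).le, ← ENNReal.ofReal_mul (hw0 y).le, delayedAcceptance_flux_symm_real hw0 hw₁ x y]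

omit [MeasurableSpace Ω] in
/-- The delayed-acceptance probability is at most one. [ours, bookkeeping] -/
theorem delayedAcceptance_le_one {w₁ : Ω → ℝ} (hw0 : ∀ x, 0 < w x) (hw₁ : ∀ x, 0 < w₁ x) (x y : Ω) :
    ENNReal.ofReal (min 1 (w₁ y / w₁ x) * min 1 (w y * w₁ x / (w x * w₁ y))) ≤ 1 := by
  rw [← ENNReal.ofReal_one]
  refine ENNReal.ofReal_le_ofReal ?_
  have h1 : min 1 (w₁ y / w₁ x) ≤ 1 := min_le_left _ _
  have h2 : min 1 (w y * w₁ x / (w x * w₁ y)) ≤ 1 := min_le_left _ _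
  have h3 : 0 ≤ min 1 (w y * w₁ x / (w x * w₁ y)) :=
    le_min zero_le_one (div_nonneg (mul_nonneg (hw0 y).le (hw₁ x).le) (mul_nonneg (hw0 x).le (hw₁ y).le))
  calc min 1 (w₁ y / w₁ x) * min 1 (w y * w₁ x / (w x * w₁ y)) ≤ 1 * 1 :=
        mul_le_mul h1 h2 h3 zero_le_one
    _ = 1 := mul_one 1

/-- The delayed-acceptance probability is jointly measurable. [ours, bookkeeping] -/
theorem measurable_delayedAcceptance {w₁ : Ω → ℝ} (hw : Measurable w) (hw₁m : Measurable w₁) :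
    Measurable (Function.uncurry fun x y : Ω => ENNReal.ofReal (min 1 (w₁ y / w₁ x) * min 1 (w y * w₁ x / (w x * w₁ y)))) :=
  ((measurable_const.min ((hw₁m.comp measurable_snd).div (hw₁m.comp measurable_fst))).mul
    (measurable_const.min (((hw.comp measurable_snd).mul (hw₁m.comp measurable_fst)).div
      ((hw.comp measurable_fst).mul (hw₁m.comp measurable_snd))))).ennreal_ofReal

/-- **DELAYED ACCEPTANCE ON FLOW PROPOSALS IS EXACT FOR EVERY POSITIVE SURROGATE**: any Markov kernel that proposes `y ∼ q`, accepts with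
`min(1, w₁(y)/w₁(x))·min(1, w(y)w₁(x)/(w(x)w₁(y)))` and otherwise stays is reversible with respect to `π = w·q` and leaves it invariant —
whatever the flow `q` and whatever the surrogate `w₁ > 0`. [ours] -/
theorem delayedAcceptance_isReversible {w₁ : Ω → ℝ} (hw : Measurable w) (hw0 : ∀ x, 0 < w x) (hw₁m : Measurable w₁)
    (hw₁ : ∀ x, 0 < w₁ x) (K : Kernel Ω Ω) [IsMarkovKernel K]
    (hK : ∀ (x : Ω) {B : Set Ω}, MeasurableSet B → K x B =
      ∫⁻ y in B, ENNReal.ofReal (min 1 (w₁ y / w₁ x) * min 1 (w y * w₁ x / (w x * w₁ y))) ∂q +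
        (1 - ∫⁻ y, ENNReal.ofReal (min 1 (w₁ y / w₁ x) * min 1 (w y * w₁ x / (w x * w₁ y))) ∂q) * B.indicator 1 x) :
    Kernel.IsReversible K (q.withDensity fun x => ENNReal.ofReal (w x)) ∧
      Kernel.Invariant K (q.withDensity fun x => ENNReal.ofReal (w x)) :=
  ⟨fluxSymmetric_isReversible hw (measurable_delayedAcceptance hw hw₁m) (delayedAcceptance_flux_symm hw0 hw₁) K hK,
    fluxSymmetric_invariant hw (measurable_delayedAcceptance hw hw₁m) (delayedAcceptance_flux_symm hw0 hw₁) K hK⟩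

/-- `min(1, u)·min(1, v) ≤ min(1, u·v)` for `u, v ≥ 0`. [folklore] -/
theorem min_one_mul_min_one_le {u v : ℝ} (hu : 0 ≤ u) (hv : 0 ≤ v) : min 1 u * min 1 v ≤ min 1 (u * v) := by
  refine le_min ?_ ?_
  · calc min 1 u * min 1 v ≤ 1 * 1 := mul_le_mul (min_le_left _ _) (min_le_left _ _) (le_min zero_le_one hv) zero_le_one
      _ = 1 := mul_one 1
  · rcases le_total u 1 with hu1 | hu1
    · rw [min_eq_right hu1]
      exact mul_le_mul_of_nonneg_left (min_le_right _ _) hu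
    · rcases le_total v 1 with hv1 | hv1
      · rw [min_eq_right hv1]
        calc min 1 u * v ≤ u * v := mul_le_mul_of_nonneg_right (min_le_right _ _) hv
          _ = u * v := rfl
      · rw [min_eq_left hu1, min_eq_left hv1, one_mul]
        calc (1 : ℝ) = 1 * 1 := (mul_one 1).symm
          _ ≤ u * v := mul_le_mul hu1 hv1 zero_le_one hu

omit [MeasurableSpace Ω] in
/-- **THE PRICE OF SCREENING**: the two-stage rule never accepts more than the one-stage Metropolis rule, pointwise:
`min(1, w₁(y)/w₁(x))·min(1, w(y)w₁(x)/(w(x)w₁(y))) ≤ min(1, w(y)/w(x))`. [ours] -/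
theorem delayedAcceptance_le_imhAccept {w₁ : Ω → ℝ} (hw0 : ∀ x, 0 < w x) (hw₁ : ∀ x, 0 < w₁ x) (x y : Ω) :
    min 1 (w₁ y / w₁ x) * min 1 (w y * w₁ x / (w x * w₁ y)) ≤ imhAccept w x y := by
  unfold imhAccept
  have h := min_one_mul_min_one_le (div_nonneg (hw₁ y).le (hw₁ x).le)
    (div_nonneg (mul_nonneg (hw0 y).le (hw₁ x).le) (mul_nonneg (hw0 x).le (hw₁ y).le)) (u := w₁ y / w₁ x)
  have heq : w₁ y / w₁ x * (w y * w₁ x / (w x * w₁ y)) = w y / w x := by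
    have h1 := (hw₁ x).ne'; have h2 := (hw₁ y).ne'; have h3 := (hw0 x).ne'
    field_simp
  rwa [heq] at h

omit [IsProbabilityMeasure q] in
/-- … hence in the mean: the delayed-acceptance mass from `x` is at most the Metropolis acceptance mass `∫ min(1, w(y)/w(x)) q(dy)`. [ours] -/
theorem delayedAcceptance_mass_le {w₁ : Ω → ℝ} (hw0 : ∀ x, 0 < w x) (hw₁ : ∀ x, 0 < w₁ x) (x : Ω) :
    ∫⁻ y, ENNReal.ofReal (min 1 (w₁ y / w₁ x) * min 1 (w y * w₁ x / (w x * w₁ y))) ∂q ≤ imhAcceptMass q w x :=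
  lintegral_mono fun y => ENNReal.ofReal_le_ofReal (delayedAcceptance_le_imhAccept hw0 hw₁ x y)

omit [MeasurableSpace Ω] in
/-- `min(1, u)·min(1, t) ≥ min(t, t⁻¹)·min(1, u·t)` for `u, t > 0`. [folklore] -/
theorem min_one_mul_min_one_ge {u t : ℝ} (hu : 0 < u) (ht : 0 < t) : min t t⁻¹ * min 1 (u * t) ≤ min 1 u * min 1 t := by
  rcases le_total t 1 with ht1 | ht1
  · -- `t ≤ 1`: `min t t⁻¹ = t`, `min 1 t = t`, and `min 1 (u t) ≤ min 1 u`
    have hinv : t ≤ t⁻¹ := le_trans ht1 (one_le_inv_iff₀.2 ⟨ht, ht1⟩)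
    rw [min_eq_left hinv, min_eq_right ht1, mul_comm (min 1 u) t]
    refine mul_le_mul_of_nonneg_left (min_le_min le_rfl ?_) ht.le
    calc u * t ≤ u * 1 := mul_le_mul_of_nonneg_left ht1 hu.le
      _ = u := mul_one u
  · -- `t ≥ 1`: `min t t⁻¹ = t⁻¹`, `min 1 t = 1`, and `t⁻¹·min 1 (u t) ≤ min 1 u`
    have hinv : t⁻¹ ≤ t := le_trans (inv_le_one_of_one_le₀ ht1) ht1
    rw [min_eq_right hinv, min_eq_left ht1, mul_one]
    refine le_min ?_ ?_
    · calc t⁻¹ * min 1 (u * t) ≤ t⁻¹ * 1 := mul_le_mul_of_nonneg_left (min_le_left _ _) (inv_nonneg.2 ht.le)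
        _ ≤ 1 := by rw [mul_one]; exact inv_le_one_of_one_le₀ ht1
    · calc t⁻¹ * min 1 (u * t) ≤ t⁻¹ * (u * t) := mul_le_mul_of_nonneg_left (min_le_right _ _) (inv_nonneg.2 ht.le)
        _ = u := by field_simp

omit [MeasurableSpace Ω] in
/-- **WHAT THE SURROGATE'S ERROR COSTS IN ACCEPTANCE**: with `t = (w(y)/w(x))/(w₁(y)/w₁(x))` the ratio by which the surrogate misjudges the
move, `a_DA(x, y) ≥ min(t, 1/t)·min(1, w(y)/w(x))` — a surrogate that gets every log-ratio right to within `δ` (`e^{−δ} ≤ t ≤ e^{δ}`) keeps at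
least the fraction `e^{−δ}` of the Metropolis acceptance while sparing the exact weight on every stage-1 rejection. [ours] -/
theorem delayedAcceptance_ge {w₁ : Ω → ℝ} (hw0 : ∀ x, 0 < w x) (hw₁ : ∀ x, 0 < w₁ x) (x y : Ω) :
    min ((w y / w x) / (w₁ y / w₁ x)) ((w y / w x) / (w₁ y / w₁ x))⁻¹ * imhAccept w x y ≤
      min 1 (w₁ y / w₁ x) * min 1 (w y * w₁ x / (w x * w₁ y)) := by
  unfold imhAccept
  have hu : 0 < w₁ y / w₁ x := div_pos (hw₁ y) (hw₁ x)
  have ht : 0 < (w y / w x) / (w₁ y / w₁ x) := div_pos (div_pos (hw0 y) (hw0 x)) hu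
  have h := min_one_mul_min_one_ge hu ht
  have hx := (hw0 x).ne'; have hy := (hw0 y).ne'; have h1x := (hw₁ x).ne'; have h1y := (hw₁ y).ne'
  have h1 : w₁ y / w₁ x * (w y / w x / (w₁ y / w₁ x)) = w y / w x := by
    field_simp
  have h2 : w y * w₁ x / (w x * w₁ y) = w y / w x / (w₁ y / w₁ x) := by
    field_simp
  rw [h1] at h
  rw [h2]
  exact h

omit [MeasurableSpace Ω] in
/-- … in exponential form: `e^{−δ} ≤ t ≤ e^{δ}` ⇒ `a_DA ≥ e^{−δ}·min(1, w(y)/w(x))`. [ours] -/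
theorem delayedAcceptance_ge_exp {w₁ : Ω → ℝ} (hw0 : ∀ x, 0 < w x) (hw₁ : ∀ x, 0 < w₁ x) (x y : Ω) {δ : ℝ}
    (hlo : Real.exp (-δ) ≤ (w y / w x) / (w₁ y / w₁ x)) (hhi : (w y / w x) / (w₁ y / w₁ x) ≤ Real.exp δ) :
    Real.exp (-δ) * imhAccept w x y ≤ min 1 (w₁ y / w₁ x) * min 1 (w y * w₁ x / (w x * w₁ y)) := by
  refine le_trans (mul_le_mul_of_nonneg_right (le_min hlo ?_) (imhAccept_nonneg hw0 x y)) (delayedAcceptance_ge hw0 hw₁ x y)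
  have ht : 0 < (w y / w x) / (w₁ y / w₁ x) := div_pos (div_pos (hw0 y) (hw0 x)) (div_pos (hw₁ y) (hw₁ x))
  rw [Real.exp_neg]
  exact inv_anti₀ ht hhi

/-! ## §4 The Kennedy–Kuti linear rule ("noise without noise") -/

omit [MeasurableSpace Ω] in
/-- **Linear-rule flux symmetry**: `w(x)·l(1 + w(y)/w(x)) = l(w(x) + w(y)) = w(y)·l(1 + w(x)/w(y))`. [ours] -/
theorem linearAccept_flux_symm (hw0 : ∀ x, 0 < w x) (l : ℝ) (x y : Ω) :
    ENNReal.ofReal (w x) * ENNReal.ofReal (l * (1 + w y / w x)) = ENNReal.ofReal (w y) * ENNReal.ofReal (l * (1 + w x / w y)) := by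
  rw [← ENNReal.ofReal_mul (hw0 x).le, ← ENNReal.ofReal_mul (hw0 y).le]
  congr 1
  have hx := (hw0 x).ne'; have hy := (hw0 y).ne'
  field_simp
  ring

omit [MeasurableSpace Ω] in
/-- The linear rule is a probability as long as `l(1 + R) ≤ 1` for a bound `R` on the weight ratios ("no probability-bound violation"). [ours] -/
theorem linearAccept_le_one (hw0 : ∀ x, 0 < w x) {l R : ℝ} (hl : 0 ≤ l) (hlR : l * (1 + R) ≤ 1) (hR : ∀ x y, w y / w x ≤ R) (x y : Ω) :
    ENNReal.ofReal (l * (1 + w y / w x)) ≤ 1 := by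
  have _ := hw0
  rw [← ENNReal.ofReal_one]
  refine ENNReal.ofReal_le_ofReal (le_trans ?_ hlR)
  exact mul_le_mul_of_nonneg_left (by linarith [hR x y]) hl

/-- The linear rule is jointly measurable. [ours, bookkeeping] -/
theorem measurable_linearAccept (hw : Measurable w) (l : ℝ) :
    Measurable (Function.uncurry fun x y : Ω => ENNReal.ofReal (l * (1 + w y / w x))) :=
  (measurable_const.mul (measurable_const.add ((hw.comp measurable_snd).div (hw.comp measurable_fst)))).ennreal_ofReal

/-- **THE KENNEDY–KUTI LINEAR RULE ON FLOW PROPOSALS IS EXACT ON A GENERAL STATE SPACE**: any Markov kernel proposing `y ∼ q` and accepting with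
probability `l(1 + w(y)/w(x))` (with `l ≥ 0` small enough that this is a probability) is reversible for `π = w·q` and leaves it invariant.
[ours] -/
theorem linearAccept_isReversible (hw : Measurable w) (hw0 : ∀ x, 0 < w x) (l : ℝ) (K : Kernel Ω Ω) [IsMarkovKernel K]
    (hK : ∀ (x : Ω) {B : Set Ω}, MeasurableSet B → K x B = ∫⁻ y in B, ENNReal.ofReal (l * (1 + w y / w x)) ∂q +
      (1 - ∫⁻ y, ENNReal.ofReal (l * (1 + w y / w x)) ∂q) * B.indicator 1 x) :
    Kernel.IsReversible K (q.withDensity fun x => ENNReal.ofReal (w x)) ∧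
      Kernel.Invariant K (q.withDensity fun x => ENNReal.ofReal (w x)) :=
  ⟨fluxSymmetric_isReversible hw (measurable_linearAccept hw l) (linearAccept_flux_symm hw0 l) K hK,
    fluxSymmetric_invariant hw (measurable_linearAccept hw l) (linearAccept_flux_symm hw0 l) K hK⟩

/-- **"NOISE WITHOUT NOISE"**: because the rule is LINEAR in the ratio, running it with an unbiased ESTIMATE `ρ̂` of `w(y)/w(x)` (fresh noise
`ξ ∼ μ` at every test) accepts, on average over the noise, with exactly the linear rule's probability — so the chain as run IS the kernel of
`linearAccept_isReversible`, provided the realised value `l(1 + ρ̂)` never leaves `[0, 1]`. [ours] -/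
theorem linearAccept_noise_average {Ξ : Type*} [MeasurableSpace Ξ] (μ : Measure Ξ) [IsProbabilityMeasure μ] {ρ : Ξ → ℝ}
    (hρi : Integrable ρ μ) {r : ℝ} (hunb : ∫ ξ, ρ ξ ∂μ = r) (l : ℝ) :
    ∫ ξ, l * (1 + ρ ξ) ∂μ = l * (1 + r) := by
  rw [integral_const_mul, integral_add (integrable_const 1) hρi, integral_const, hunb]
  simp

omit [MeasurableSpace Ω] in
/-- **THE PRICE OF LINEARITY**: wherever the rule is a probability in BOTH directions (`l(1 + w(x)/w(y)) ≤ 1` as well), it accepts at most as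
often as Metropolis: `l(1 + w(y)/w(x)) ≤ min(1, w(y)/w(x))`. [ours] -/
theorem linearAccept_le_imhAccept (hw0 : ∀ x, 0 < w x) {l : ℝ} (x y : Ω) (hfwd : l * (1 + w y / w x) ≤ 1)
    (hrev : l * (1 + w x / w y) ≤ 1) : l * (1 + w y / w x) ≤ imhAccept w x y := by
  unfold imhAccept
  refine le_min hfwd ?_
  -- `l(1 + w y/w x) = (w y/w x)·l(1 + w x/w y) ≤ w y/w x`
  have hr : 0 < w y / w x := div_pos (hw0 y) (hw0 x)
  have heq : l * (1 + w y / w x) = (w y / w x) * (l * (1 + w x / w y)) := by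
    have hx := (hw0 x).ne'; have hy := (hw0 y).ne'
    field_simp
    ring
  rw [heq]
  calc (w y / w x) * (l * (1 + w x / w y)) ≤ (w y / w x) * 1 := mul_le_mul_of_nonneg_left hrev hr.le
    _ = w y / w x := mul_one _

end Summit.Ventures.LatticeQCDFlow.Exactness
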